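import Literature.AlgebraicGeometry.Frobenioids.PadicKummerObjectMonoid
import Literature.AlgebraicGeometry.Frobenioids.PadicFrobenioidFieldUnitsReconstruction
import Literature.AlgebraicGeometry.Frobenioids.ModelFrobenioidEndMonoid
import Literature.AlgebraicGeometry.Frobenioids.PadicKummerThm24iGalois
import Literature.AlgebraicGeometry.Frobenioids.PadicFrobenioidThm12Proofs
import HarnessLib

/-!
# Frobenioids II, Def. 2.2 (i) at the FROBENIOID level: Galois charts of an object — the descended action
# of `Aut_E(A_E) = Gal(K_A/K)` on `O^▷(A)`, `Aut_C(A) → Gal(K_A/K)`, and `μ_N(A) ≅ μ_N(K̄)` (row (α), file D2)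

Mochizuki, *The geometry of Frobenioids II*, Kyushu J. Math. **62** (2008) 401–460, §2, Definition 2.2 (i)
p. 17 [cite: MochizukiFrdII2008, Def 2.2 (i) p.17]: "the natural action by conjugation of `Aut_C(A)` on
`O^×(A)` factors through the quotient `Aut_C(A) ↠ G_A` … a natural inclusion `G_A ↪ Aut_E(A_E)`, which is
an isomorphism if, for instance, `A_D` is Galois [where we recall that `C` is `Aut`-ample — cf. Theorem 1.2
(i)]"; Remark 2.2.1 p. 18: "if `A_E = Spec(L)`, then `H_A` … act naturally on `L`, `O^□(A)`".

Definitions file (seat abc-iut-L1-t7, gen 4; GAP row G-L1t7-α, piece D2), base-agnostic. For an object `A`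
of the `p`-adic Frobenioid `C = d.frobenioid` (abc-iut-L1-t4's `PadicFrd.Datum d`), a **Galois chart**
(`GaloisChart d A K L`) identifies the field `K_A` of `A₀` with a finite normal `L ⊆ K̄` over a base field
`K` and records the homomorphism `Aut_C(A) → Gal(L/K)`, `α ↦` the field automorphism of `Base(α⁻¹)`,
together with its SURJECTIVITY ("`G_A ⥲ Aut_E(A_E)`", from `Aut`-ampleness and the Galois
correspondence for the base — supplied when the chart is built; for the base `B(G_{ℚ_p})⁰ → D₀` of §2 this
is file D3b). From a chart we CONSTRUCT, with no further input:
* `GaloisChart.galAction` — the descended action of `Gal(L/K)` on `O^▷(A)` (`ObjMonoid d A`, file D1),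
  `σ • f := α • f` for any lift `α` of `σ` (independence of the lift: abc-iut-L1-d4's Thm. 1.2 (ii)
  `conj_eq_conj_of_mapIso_eq`), and `res_smul : res α • f = α • f` — the two fields `res`, `res_smul` of
  abc-iut-L1-t7's `Def22Context.ofGalois`;
* `GaloisChart.muModel` — the `G_K`-equivariant identification `μ_N(A) ≅ μ_N(K̄)`
  (`Def22Context.MuModel`) for `μ_N(K̄) ⊆ L`, through `O^▷(A) ↪ B(A_D) ↪ K_A^× ≅ L^× ⊆ K̄`
  (abc-iut-w5-d188's `toB0_injective`, abc-iut-L1-t4's `exists_B_over_unit`).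
Then (piece D3, same file): `Def22Context.ofChart c H hH := ofGalois L H … c.res c.res_smul` — **the
Definition 2.2 context OF THE OBJECT `A`** (an instance of the Galois binding by `rfl`, so every landed
result at `ofGalois` applies verbatim) — and **`thm24i_ofChart`: Theorem 2.4 (i) for two OBJECTS of
`pᵢ`-adic Frobenioids** with charts over finite `Kᵢ ⊇ ℚ_{pᵢ}` and any isomorphism of their contexts
"induced by `Ψ`" (its construction from `Ψ` + the [FrdI] Cor. 4.10/4.11 data is piece D4), conditional on
EXACTLY `hfs` (`thm24i_ofGalois`, p416996). Nothing here concerns [IUTchIII]; universe `0` where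
`Def22Context` forces it.
-/

noncomputable section

namespace Literature.AlgebraicGeometry.Frobenioids

namespace PadicFrd

namespace Datum

open CategoryTheory Opposite Function Field IntermediateField ValuativeRel
open scoped ValuativeRel
open Literature.NumberTheory.GaloisRepresentations
open PadicKummer PadicKummer.Def22Context

universe v u

section General

variable {D : Type u} [Category.{v} D] {p : ℕ} [Fact p.Prime] (d : Datum D p) (A : d.frobenioid)
  (K : Type) [Field K] (L : IntermediateField K (AlgebraicClosure K))

/-- **A Galois chart of the object `A`** (Def. 2.2 (i) / Rmk. 2.2.1: "`A_E = Spec(L)`", "`G_A ⥲ Aut_E(A_E)`"):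
an identification `χ : K_A ≅ L` of the field of `A₀` with a finite normal `L ⊆ K̄` over `K`, and the
homomorphism `res : Aut_C(A) → Gal(L/K)` sending `α` to the field automorphism underlying `Base(α⁻¹)`
read through `χ` (`res_apply`), which is surjective (`res_surjective`: `C` is `Aut`-ample, Thm. 1.2 (i),
and `A_D` is Galois). [cite: MochizukiFrdII2008, Def 2.2 (i) p.17] -/
structure GaloisChart : Type (max u v) where
  /-- `K_A ≅ L` -/
  χ : d.fld A.base ≃+* L
  /-- `Aut_C(A) → Aut_E(A_E) = Gal(L/K)` -/
  res : Aut A →* (L ≃ₐ[K] L)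
  /-- `res α` is the field automorphism of `Base(α⁻¹)` -/
  res_apply : ∀ (α : Aut A) (x : d.fld A.base),
    ((res α (χ x) : L) : AlgebraicClosure K) = ((χ ((d.toBaseZero.map α.inv).alg x) : L) : AlgebraicClosure K)
  /-- "`G_A ⥲ Aut_E(A_E)`" -/
  res_surjective : Surjective res

namespace GaloisChart

variable {d A K L} (c : GaloisChart d A K L)

/-- `res_apply` inside `L`. [cite: MochizukiFrdII2008, Def 2.2 (i) p.17] -/
theorem res_apply' (α : Aut A) (x : d.fld A.base) : c.res α (c.χ x) = c.χ ((d.toBaseZero.map α.inv).alg x) :=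
  Subtype.ext (c.res_apply α x)

/-- A lift of `σ ∈ Gal(L/K)` to `Aut_C(A)`. [cite: MochizukiFrdII2008, Def 2.2 (i) p.17] -/
def lift (σ : L ≃ₐ[K] L) : Aut A := Classical.choose (c.res_surjective σ)

/-- `res (lift σ) = σ`. [cite: MochizukiFrdII2008, Def 2.2 (i) p.17] -/
@[simp] theorem res_lift (σ : L ≃ₐ[K] L) : c.res (c.lift σ) = σ := Classical.choose_spec (c.res_surjective σ)

/-- Automorphisms with the same image in `Gal(L/K)` have the same image in `Aut_{D₀}(A₀)` (the field map
of `Base(α⁻¹)` is `χ⁻¹ ∘ res α ∘ χ`). [cite: MochizukiFrdII2008, Thm 1.2 (ii) p.9] -/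
theorem mapIso_eq_of_res_eq {α β : Aut A} (h : c.res α = c.res β) :
    d.toBaseZero.mapIso α = d.toBaseZero.mapIso β := by
  have hinv : d.toBaseZero.map α.inv = d.toBaseZero.map β.inv := by
    apply PadicFld.hom_ext
    apply RingHom.ext
    intro x
    apply c.χ.injective
    rw [← c.res_apply', ← c.res_apply', h]
  have hsymm : (d.toBaseZero.mapIso α).symm = (d.toBaseZero.mapIso β).symm :=
    Iso.ext (by rw [Iso.symm_hom, Iso.symm_hom, Functor.mapIso_inv, Functor.mapIso_inv, hinv])
  rw [← Iso.symm_symm_eq (d.toBaseZero.mapIso α), hsymm, Iso.symm_symm_eq]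

/-- **Thm. 1.2 (ii)**: automorphisms with the same image in `Gal(L/K)` act identically on `O^▷(A)`
(abc-iut-L1-d4's `conj_eq_conj_of_mapIso_eq`). [cite: MochizukiFrdII2008, Thm 1.2 (ii) p.9] -/
theorem smul_eq_of_res_eq {α β : Aut A} (h : c.res α = c.res β) (f : ObjMonoid d A) : α • f = β • f := by
  apply ObjMonoid.ext
  rw [ObjMonoid.hom_smul, ObjMonoid.hom_smul]
  have h' : d.toBaseZero.mapIso α.symm = d.toBaseZero.mapIso β.symm := by
    rw [Functor.mapIso_symm, Functor.mapIso_symm, c.mapIso_eq_of_res_eq h]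
  exact d.conj_eq_conj_of_mapIso_eq A α.symm β.symm h' f.hom f.hom_mem

/-! ### The descended action of `Gal(L/K)` on `O^▷(A)` -/

/-- **The descended action of `Aut_E(A_E) = Gal(L/K)` on `O^▷(A)`** (Def. 2.2 (i): the conjugation
action "factors through the quotient `Aut_C(A) ↠ G_A`" `⥲ Aut_E(A_E)`): `σ • f := α • f` for any lift
`α ∈ Aut_C(A)` of `σ`. [cite: MochizukiFrdII2008, Def 2.2 (i) p.17] -/
@[reducible] def galAction : MulDistribMulAction (L ≃ₐ[K] L) (ObjMonoid d A) where
  smul σ f := c.lift σ • f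
  one_smul f := by
    change c.lift 1 • f = f
    rw [c.smul_eq_of_res_eq (β := 1) (by rw [res_lift, map_one]), one_smul]
  mul_smul σ τ f := by
    change c.lift (σ * τ) • f = c.lift σ • (c.lift τ • f)
    rw [← mul_smul, c.smul_eq_of_res_eq (β := c.lift σ * c.lift τ) (by rw [res_lift, map_mul, res_lift, res_lift])]
  smul_mul σ f g := by
    change c.lift σ • (f * g) = c.lift σ • f * c.lift σ • g
    exact smul_mul' _ _ _
  smul_one σ := by
    change c.lift σ • (1 : ObjMonoid d A) = 1
    exact smul_one _

/-- Unfolding `galAction`: `σ • f = (lift σ) • f`. [cite: MochizukiFrdII2008, Def 2.2 (i) p.17] -/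
theorem galAction_smul (σ : L ≃ₐ[K] L) (f : ObjMonoid d A) :
    (letI := c.galAction; σ • f) = c.lift σ • f := rfl

/-- **`res_smul`**: the conjugation action of `Aut_C(A)` IS the descended action through `res`
(the field `res_smul` of `Def22Context.ofGalois`). [cite: MochizukiFrdII2008, Def 2.2 (i) p.17] -/
theorem res_smul (α : Aut A) (f : ObjMonoid d A) : (letI := c.galAction; c.res α • f) = α • f := by
  rw [galAction_smul]
  exact c.smul_eq_of_res_eq (by rw [res_lift]) f

/-! ### `O^▷(A) ↪ K̄` and `μ_N(A) ≅ μ_N(K̄)` -/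

/-- `O^▷(A) → K̄`: `f ↦` the image in `K̄` of `χ(u_f|_{K^×})` (`O^▷(A) → B(A_D) → K_A^× ≅ L^× ⊆ K̄`).
[cite: MochizukiFrdII2008, Rmk 2.2.1 p.18] -/
def toClosure : ObjMonoid d A →* AlgebraicClosure K :=
  ((algebraMap L (AlgebraicClosure K) : L →+* AlgebraicClosure K).toMonoidHom.comp
    c.χ.toRingHom.toMonoidHom).comp
    ((Units.coeHom (d.fld A.base)).comp ((d.toB0.app (op A.base)).hom.comp ObjMonoid.unitHom))

/-- Unfolding `toClosure`. [cite: MochizukiFrdII2008, Rmk 2.2.1 p.18] -/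
theorem toClosure_apply (f : ObjMonoid d A) :
    c.toClosure f = ((c.χ (@Units.val (d.fld A.base) _ ((d.toB0.app (op A.base)).hom (ObjMonoid.unitHom f))) :
      L) : AlgebraicClosure K) := rfl

/-- `O^▷(A) → K̄` is injective (`O^▷(A) ↪ B(A_D)` file D1, `B(A_D) ↪ K_A^×` abc-iut-w5-d188's
`toB0_injective`). [cite: MochizukiFrdII2008, Rmk 2.2.1 p.18] -/
theorem toClosure_injective : Injective c.toClosure := by
  intro f g h
  rw [toClosure_apply, toClosure_apply] at h
  have h1 := (algebraMap L (AlgebraicClosure K)).injective h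
  exact ObjMonoid.unitHom_injective (d.toB0_injective _ (Units.ext (c.χ.injective h1)))

/-- The rational function of `α • f` in `K_A^×` is the field automorphism of `Base(α⁻¹)` applied to that of
`f` (naturality of `B → B₀|_D`, abc-iut-w5-d188's `toB0_naturality_apply`).
[cite: MochizukiFrdII2008, Def 2.2 (i) p.17] -/
theorem coe_toB0_unitHom_smul (α : Aut A) (f : ObjMonoid d A) :
    @Units.val (d.fld A.base) _ ((d.toB0.app (op A.base)).hom (ObjMonoid.unitHom (α • f))) =
      (d.toBaseZero.map α.inv).alg
        (@Units.val (d.fld A.base) _ ((d.toB0.app (op A.base)).hom (ObjMonoid.unitHom f))) := by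
  rw [ObjMonoid.unitHom_smul, pull, d.toB0_naturality_apply]
  rfl

/-- **`G_K`-equivariance of `O^▷(A) → K̄`** for the descended action through `G_K ↠ Gal(L/K)`
(`L` normal over `K`): `ι (resGal L σ • f) = σ • ι f`. [cite: MochizukiFrdII2008, Rmk 2.2.1 p.18] -/
theorem toClosure_smul [Normal K L] (σ : absoluteGaloisGroup K) (f : ObjMonoid d A) :
    c.toClosure (letI := c.galAction; resGal L σ • f) = σ • c.toClosure f := by
  rw [galAction_smul, toClosure_apply, toClosure_apply, coe_toB0_unitHom_smul, ← c.res_apply, res_lift,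
    coe_resGal_apply]

variable (N : ℕ)

/-- For `ζ ∈ μ_N(K̄) ∩ L` there is `f ∈ O^▷(A)` INVERTIBLE in `O^▷(A)` mapping to `ζ` (roots of unity are
units of `O_{K_A}`, so `(1, id, 0, u) ∈ O^×(A)` with `u ∈ B(A_D)` over them: abc-iut-L1-t4's
`exists_B_over_unit`). [cite: MochizukiFrdII2008, Rmk 2.2.1 p.18] -/
theorem exists_unit_toClosure_eq (hN : 0 < N) (ζ : rootsOfUnity N (AlgebraicClosure K))
    (hζ : ((ζ : (AlgebraicClosure K)ˣ) : AlgebraicClosure K) ∈ L) :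
    ∃ u : (ObjMonoid d A)ˣ, c.toClosure (u : ObjMonoid d A) = ((ζ : (AlgebraicClosure K)ˣ) : AlgebraicClosure K) := by
  -- the element of `K_A` and its inverse
  set y : L := ⟨_, hζ⟩ with hy
  have hyN : y ^ N = 1 := Subtype.ext (by
    rw [hy]
    change (((ζ : (AlgebraicClosure K)ˣ) : AlgebraicClosure K)) ^ N = 1
    rw [← Units.val_pow_eq_pow_val, (mem_rootsOfUnity N (ζ : (AlgebraicClosure K)ˣ)).mp ζ.2, Units.val_one])
  set x : d.fld A.base := c.χ.symm y with hx
  have hxN : x ^ N = 1 := by rw [hx, ← map_pow, hyN, map_one]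
  have hx0 : x ≠ 0 := fun h0 => by
    rw [h0, zero_pow hN.ne'] at hxN
    exact zero_ne_one hxN
  -- valuation `1`
  have hval : ∀ z : d.fld A.base, z ^ N = 1 → valuation (d.fld A.base) z = 1 := by
    intro z hzN
    have hv : valuation (d.fld A.base) z ^ N = 1 := by rw [← map_pow, hzN, map_one]
    rcases lt_trichotomy (valuation (d.fld A.base) z) 1 with hlt | heq | hgt
    · exact absurd hv (ne_of_lt (pow_lt_one₀ zero_le hlt hN.ne'))
    · exact heq
    · exact absurd hv (ne_of_gt (one_lt_pow₀ hgt hN.ne'))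
  set xu : (d.fld A.base)ˣ := Units.mk0 x hx0 with hxu
  have hxu_mem : xu ∈ unitSubgroup (d.fld A.base) := hval x hxN
  have hxu_inv_mem : xu⁻¹ ∈ unitSubgroup (d.fld A.base) := inv_mem hxu_mem
  -- elements of `B(A_D)` over `x`, `x⁻¹` with trivial divisor, and the endomorphisms `(1, id, 0, b)`
  obtain ⟨b, hb, hbdiv⟩ := d.exists_B_over_unit (op A.base) xu hxu_mem
  obtain ⟨b', hb', hb'div⟩ := d.exists_B_over_unit (op A.base) xu⁻¹ hxu_inv_mem
  obtain ⟨f, hf, hfu, -⟩ := ModelFrobenioid.exists_mem_endSubmonoid_unit_eq A 1 b (by rw [map_one, hbdiv])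
  obtain ⟨g, hg, hgu, -⟩ := ModelFrobenioid.exists_mem_endSubmonoid_unit_eq A 1 b' (by rw [map_one, hb'div])
  have hbb' : b * b' = 1 := d.toB0_injective _ (by
    rw [map_mul, hb, hb', map_one]
    exact mul_inv_cancel xu)
  have hfg : ObjMonoid.mk f hf * ObjMonoid.mk g hg = 1 := ObjMonoid.unitHom_injective (by
    rw [map_mul, map_one, ObjMonoid.unitHom_apply, ObjMonoid.unitHom_apply, ObjMonoid.hom_mk,
      ObjMonoid.hom_mk, hfu, hgu, hbb'])
  refine ⟨⟨ObjMonoid.mk f hf, ObjMonoid.mk g hg, hfg, by rw [mul_comm, hfg]⟩, ?_⟩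
  change c.toClosure (ObjMonoid.mk f hf) = _
  rw [toClosure_apply, ObjMonoid.unitHom_apply, ObjMonoid.hom_mk, hfu, hb, hxu, Units.val_mk0, hx,
    RingEquiv.apply_symm_apply]

end GaloisChart

end General

/-! ### `μ_N(A) ≅ μ_N(K̄)` (universe `0`, as required by `Def22Context`) -/

section UniverseZero

variable {D : Type} [SmallCategory D] {p : ℕ} [Fact p.Prime] {d : Datum D p} {A : d.frobenioid}
  {K : Type} [Field K] {L : IntermediateField K (AlgebraicClosure K)} [Normal K L]
  (c : GaloisChart d A K L) (N : ℕ)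

/-- **`μ_N(A) ≅ μ_N(K̄)`, `G_K`-equivariantly** (abc-iut-L1-t7's `Def22Context.MuModel` for
`O = O^▷(A)` with the descended action), when `μ_N(K̄) ⊆ L` ("`A` is `μ_N`-saturated", Def. 2.1 (i)).
[cite: MochizukiFrdII2008, Def 2.2 (ii) p.18] -/
def GaloisChart.muModel [NeZero N] (hμ : ∀ ζ : rootsOfUnity N (AlgebraicClosure K),
    ((ζ : (AlgebraicClosure K)ˣ) : AlgebraicClosure K) ∈ L) :
    letI := c.galAction; MuModel L (ObjMonoid d A) N :=
  letI := c.galAction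
  MuModel.ofMonoidHom c.toClosure c.toClosure_injective (fun σ f => c.toClosure_smul σ f)
    (fun ζ => c.exists_unit_toClosure_eq N (NeZero.pos N) ζ (hμ ζ))

end UniverseZero



end Datum

end PadicFrd

namespace PadicKummer

namespace Def22Context

open CategoryTheory Field IntermediateField Kummer Function
open Literature.NumberTheory.GaloisRepresentations
open PadicFrd PadicFrd.Datum

/-! ### The context of an object -/

section OfChart

variable {D : Type} [SmallCategory D] {p : ℕ} [Fact p.Prime] {d : PadicFrd.Datum D p} {A : d.frobenioid}
  {K : Type} [Field K] {L : IntermediateField K (AlgebraicClosure K)} [Normal K L] [FiniteDimensional K L]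
  (c : d.GaloisChart A K L)
  (H : Subgroup (absoluteGaloisGroup K)) [H.Normal] (hH : IsOpen (H : Set (absoluteGaloisGroup K)))

/-- **Definition 2.2 for the object `A` of the `p`-adic Frobenioid** (p. 17): the context with
`Aut_C(A)` acting on `O^▷(A)` by conjugation, `Aut_E(A_E) = Gal(L/K)` (through the chart), `G = G_K ⊇ H`,
"`A_D` Galois" `:= IsGalois K L` — literally abc-iut-L1-t7's `ofGalois` at `AutC := Aut A`,
`O := O^▷(A)`, `res := c.res` (reducible, like `ofGalois`). [cite: MochizukiFrdII2008, Def 2.2 (i) p.17] -/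
abbrev ofChart : Def22Context :=
  letI := c.galAction
  ofGalois L H hH (AutC := Aut A) (O := ObjMonoid d A) c.res c.res_smul

/-- `ofChart` IS the Galois binding `ofGalois` (with the descended action of the chart).
[cite: MochizukiFrdII2008, Def 2.2 (i) p.17] -/
theorem ofChart_eq : ofChart c H hH = (letI := c.galAction;
    ofGalois L H hH (AutC := Aut A) (O := ObjMonoid d A) c.res c.res_smul) := rfl

/-- `Aut_C = Aut_C(A)`. [cite: MochizukiFrdII2008, Def 2.2 (i) p.17] -/
theorem AutC_ofChart : (ofChart c H hH).AutC = Aut A := rfl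

/-- `O^□ = O^▷(A)`. [cite: MochizukiFrdII2008, Def 2.2 (iii) p.18] -/
theorem O_ofChart : (ofChart c H hH).O = ObjMonoid d A := rfl

/-- `G = G_K`. [cite: MochizukiFrdII2008, Def 2.2 (i) p.17] -/
theorem G_ofChart : (ofChart c H hH).G = absoluteGaloisGroup K := rfl

/-- `Aut_E(A_E) = Gal(L/K)`. [cite: MochizukiFrdII2008, Def 2.2 (i) p.17] -/
theorem AutE_ofChart : (ofChart c H hH).AutE = (L ≃ₐ[K] L) := rfl

/-- `Aut_C(A) → Aut_E(A_E)` is the chart's `res`. [cite: MochizukiFrdII2008, Def 2.2 (i) p.17] -/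
theorem res_ofChart : (ofChart c H hH).res = c.res := rfl

/-- "`G_A ↪ Aut_E(A_E)` is an isomorphism" holds for the object's context (`res` is surjective: `C` is
`Aut`-ample and `A_D` is Galois). [cite: MochizukiFrdII2008, Def 2.2 (i) p.17] -/
theorem galoisSurjective_ofChart : (ofChart c H hH).GaloisSurjective := by
  intro _ τ
  obtain ⟨α, hα⟩ := c.res_surjective τ
  exact ⟨QuotientGroup.mk α, hα⟩

end OfChart

/-! ### Theorem 2.4 (i) for two objects of `p`-adic Frobenioids -/

section Thm24iChart

variable {p₁ p₂ : ℕ} [Fact p₁.Prime] [Fact p₂.Prime]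
  {D₁ : Type} [SmallCategory D₁] {d₁ : PadicFrd.Datum D₁ p₁} {A₁ : d₁.frobenioid}
  {D₂ : Type} [SmallCategory D₂] {d₂ : PadicFrd.Datum D₂ p₂} {A₂ : d₂.frobenioid}
  {K₁ : Type} [Field K₁] [Algebra ℚ_[p₁] K₁] [FiniteDimensional ℚ_[p₁] K₁]
  {K₂ : Type} [Field K₂] [Algebra ℚ_[p₂] K₂] [FiniteDimensional ℚ_[p₂] K₂]
  {L₁ : IntermediateField K₁ (AlgebraicClosure K₁)} [Normal K₁ L₁] [FiniteDimensional K₁ L₁]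
  {L₂ : IntermediateField K₂ (AlgebraicClosure K₂)} [Normal K₂ L₂] [FiniteDimensional K₂ L₂]
  (c₁ : d₁.GaloisChart A₁ K₁ L₁) (c₂ : d₂.GaloisChart A₂ K₂ L₂)
  {H₁ : Subgroup (absoluteGaloisGroup K₁)} [H₁.Normal] {hH₁ : IsOpen (H₁ : Set (absoluteGaloisGroup K₁))}
  {H₂ : Subgroup (absoluteGaloisGroup K₂)} [H₂.Normal] {hH₂ : IsOpen (H₂ : Set (absoluteGaloisGroup K₂))}
  (e : Iso (ofChart c₁ H₁ hH₁) (ofChart c₂ H₂ hH₂)) (N : ℕ) [NeZero N]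
  (hμ₁ : ∀ ζ : rootsOfUnity N (AlgebraicClosure K₁), ((ζ : (AlgebraicClosure K₁)ˣ) : AlgebraicClosure K₁) ∈ L₁)
  (hμ₂ : ∀ ζ : rootsOfUnity N (AlgebraicClosure K₂), ((ζ : (AlgebraicClosure K₂)ˣ) : AlgebraicClosure K₂) ∈ L₂)

omit [FiniteDimensional ℚ_[p₁] K₁] in
include p₁ c₁ in
/-- `H` is locally compact for the object's context over `K ⊇ ℚ_p` finite (discharges the instance
hypothesis below). [cite: MochizukiFrdII2008, Def 2.2 (i) p.17] -/
theorem locallyCompactSpace_H_ofChart : LocallyCompactSpace (ofChart c₁ H₁ hH₁).H :=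
  letI := c₁.galAction
  locallyCompactSpace_H_ofGalois_mlf p₁ L₁ H₁ hH₁ c₁.res c₁.res_smul

variable [LocallyCompactSpace (ofChart c₁ H₁ hH₁).H] [LocallyCompactSpace (ofChart c₂ H₂ hH₂).H]

/-- **Theorem 2.4 (i) for two OBJECTS `A₁`, `A₂` of `pᵢ`-adic Frobenioids** (FrdII pp. 19–20), with Galois
charts over finite extensions `Kᵢ ⊇ ℚ_{pᵢ}`, `μ_N(K̄ᵢ) ⊆ Lᵢ`, and an isomorphism `e` of their Definition 2.2
contexts "induced by `Ψ`": for `A₁` `(N, H₁)`-saturated and any normalisation `F_N(A₁) ≅ ℤ/N`, the typed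
`Thm24i` holds for `e.thm24Data N` and the cup-product duality isomorphisms (`μ_N(Aᵢ) ≅ μ_N(K̄ᵢ)` =
`GaloisChart.muModel`), conditional on EXACTLY `hfs` ("`Φ₁` fieldwise saturated iff `Φ₂`", row L03);
`p₁ = p₂`, the saturation transfer and the Kummer / reciprocity compatibilities are PROVED
(`thm24i_ofGalois`). [cite: MochizukiFrdII2008, Thm 2.4 (i) p.19] -/
theorem thm24i_ofChart (fs₁ fs₂ : Prop) (hfs : fs₁ ↔ fs₂) (eFN₁ : FN (ofChart c₁ H₁ hH₁) N ≃+ ZMod N)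
    (hc₁ : IsNHSaturated (ofChart c₁ H₁ hH₁) N) :
    letI := c₁.galAction; letI := c₂.galAction
    Thm24i (ofChart c₁ H₁ hH₁) (ofChart c₂ H₂ hH₂) N p₁ p₂ fs₁ fs₂ (e.thm24Data N)
      ((ofChart c₁ H₁ hH₁).dualityIsoOfLocalDuality N eFN₁ hc₁
        (cupDualH_bijective_ofGalois_mlf p₁ L₁ H₁ hH₁ c₁.res c₁.res_smul (c₁.muModel N hμ₁)))
      ((ofChart c₂ H₂ hH₂).dualityIsoOfLocalDuality N ((e.isoFN N).symm.trans eFN₁)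
        ((e.isNHSaturated_iff N).mp hc₁)
        (cupDualH_bijective_ofGalois_mlf p₂ L₂ H₂ hH₂ c₂.res c₂.res_smul (c₂.muModel N hμ₂))) :=
  letI := c₁.galAction; letI := c₂.galAction
  thm24i_ofGalois e N (c₁.muModel N hμ₁) (c₂.muModel N hμ₂) fs₁ fs₂ hfs eFN₁ hc₁

end Thm24iChart

end Def22Context

end PadicKummer

end Literature.AlgebraicGeometry.Frobenioids

end
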